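import Mathlib
import HarnessLib
import Summits.HubbardSuperconductivity.HubbardSuperconductivity.Theorems.KLProgrammeH10TwoPointLimitSectorMultiplierL1

/-!
# Route `KLProgramme` — engine support, route (L2): the step geometry of the uniform packaging — scale bookkeeping, the tangent step's
# length, the far-range radius `R₀`, the cell radius and the angular factors at neighbouring scales

Cell `gate-hubbard-kl`, seat p4 (C5a lead), g7.  Small self-contained lemmas consumed by `charSum_klAnisoPair_le_uniform`
(`…SectorMultiplierBound`): `scale_facts` (`Λ_{n}·4ⁿ = e₀`, `N² ≤ L`, `2πe₀² ≤ LΛ²`, `(2π/L)N² ≤ 1` under `2π·16ⁿ ≤ L`),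
`half_le_norm_tangentStep` (`|round(Nτ̂)|₂ ≥ N/2`), `twelve_mul_le_of_step` and `tangentR0_bounds`
(`R₀ = ⌊(L−1)/(2|v|₁)⌋`: `2|v|₁R₀ < L`, `R₀ ≥ L/(12N)`), `norm_momToComplex_le_two_mul`, `cellRadius_le` (`ρ ≤ ρ̄/N` for `n₂ ≤ n₁ ≤ n₂ + 1`)
and `angularFactor_le` (`1 + 2/w_m ≤ 2N`).  Everything is proved; no definitions, no named facts. [folklore]
-/

noncomputable section

namespace Summit.HubbardSuperconductivity.HubbardSuperconductivity.Theorems.TorusFourierL2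

set_option linter.dupNamespace false -- summit = problem name (single-conjunct summit), D-0017

open Literature.MathematicalPhysics.QuantumLattice Literature.MathematicalPhysics.QuantumLattice.BandSectorCounting
open Summit.HubbardSuperconductivity.HubbardSuperconductivity.Theorems.KLProgrammeLegKernels
open scoped Real

/-- **Scale bookkeeping** at `Λ = e₀4^{-n}`, `N = 2ⁿ` under the threshold `2π·16ⁿ ≤ L`:
`ΛN² = e₀`, `Λ ≤ e₀`, `ΛN ≤ e₀`, `N² ≤ L`, `2πe₀² ≤ LΛ²`, `(2π/L)N² ≤ 1`. [folklore] -/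
theorem scale_facts {e₀ : ℝ} (he : 0 < e₀) (n : ℕ) {L : ℝ} (hL16 : 2 * π * (16 : ℝ) ^ n ≤ L) :
    klScale e₀ n * ((2 : ℝ) ^ n) ^ 2 = e₀ ∧ klScale e₀ n ≤ e₀ ∧ klScale e₀ n * (2 : ℝ) ^ n ≤ e₀ ∧ ((2 : ℝ) ^ n) ^ 2 ≤ L ∧
      2 * π * e₀ ^ 2 ≤ L * klScale e₀ n ^ 2 ∧ 2 * π / L * ((2 : ℝ) ^ n) ^ 2 ≤ 1 := by
  have hπ := Real.pi_pos
  have h16p : (0 : ℝ) < (16 : ℝ) ^ n := by positivity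
  have hL : 0 < L := lt_of_lt_of_le (by positivity) hL16
  have hN1 : (1 : ℝ) ≤ (2 : ℝ) ^ n := one_le_pow₀ (by norm_num)
  have hN2eq : ((2 : ℝ) ^ n) ^ 2 = (4 : ℝ) ^ n := by rw [← pow_mul, mul_comm, pow_mul]; norm_num
  have h16 : (16 : ℝ) ^ n = ((2 : ℝ) ^ n) ^ 2 * ((2 : ℝ) ^ n) ^ 2 := by rw [hN2eq, ← mul_pow]; norm_num
  have hΛN2 : klScale e₀ n * ((2 : ℝ) ^ n) ^ 2 = e₀ := by rw [klScale, hN2eq]; field_simp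
  have hΛ : 0 < klScale e₀ n := by rw [klScale]; positivity
  have hΛe : klScale e₀ n ≤ e₀ := klScale_le_e0 he.le n
  have hN4L : ((2 : ℝ) ^ n) ^ 2 * ((2 : ℝ) ^ n) ^ 2 ≤ L := by
    rw [← h16]
    have : (16 : ℝ) ^ n ≤ 2 * π * 16 ^ n := by nlinarith only [Real.pi_gt_three, h16p]
    exact this.trans hL16
  have hsq1 : ((2 : ℝ) ^ n) ^ 2 ≤ ((2 : ℝ) ^ n) ^ 2 * ((2 : ℝ) ^ n) ^ 2 :=
    le_mul_of_one_le_right (by positivity) (one_le_pow₀ hN1)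
  refine ⟨hΛN2, hΛe, ?_, hsq1.trans hN4L, ?_, ?_⟩
  · calc klScale e₀ n * (2 : ℝ) ^ n ≤ klScale e₀ n * (2 : ℝ) ^ n * (2 : ℝ) ^ n := le_mul_of_one_le_right (by positivity) hN1
      _ = klScale e₀ n * ((2 : ℝ) ^ n) ^ 2 := by ring
      _ = e₀ := hΛN2
  · have e : e₀ ^ 2 = klScale e₀ n ^ 2 * (16 : ℝ) ^ n := by
      conv_lhs => rw [← hΛN2]
      rw [h16]; ring
    rw [e]
    calc 2 * π * (klScale e₀ n ^ 2 * (16 : ℝ) ^ n) = klScale e₀ n ^ 2 * (2 * π * 16 ^ n) := by ring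
      _ ≤ klScale e₀ n ^ 2 * L := mul_le_mul_of_nonneg_left hL16 (sq_nonneg _)
      _ = L * klScale e₀ n ^ 2 := by ring
  · rw [div_mul_eq_mul_div, div_le_one hL]
    calc 2 * π * ((2 : ℝ) ^ n) ^ 2 ≤ 2 * π * (((2 : ℝ) ^ n) ^ 2 * ((2 : ℝ) ^ n) ^ 2) := by gcongr
      _ = 2 * π * (16 : ℝ) ^ n := by rw [h16]
      _ ≤ L := hL16

/-- **`|v|₂ ≥ N/2`** for `v = round(N τ̂)`, `τ̂` a unit vector, `N = 2^{n}`: for `N ≤ 2` because `v ≠ 0` is an integer vector, for `N ≥ 4`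
because the rounding error is `≤ ½` per coordinate. [folklore] -/
theorem half_le_norm_tangentStep {g₀ g₁ : ℝ} (hN0 : 0 < Real.sqrt (g₀ ^ 2 + g₁ ^ 2)) (n : ℕ) (v : Fin 2 → ℤ)
    (hv0 : v 0 = round ((2 : ℝ) ^ n * (-g₁ / Real.sqrt (g₀ ^ 2 + g₁ ^ 2))))
    (hv1 : v 1 = round ((2 : ℝ) ^ n * (g₀ / Real.sqrt (g₀ ^ 2 + g₁ ^ 2)))) (hv : v ≠ 0) :
    (2 : ℝ) ^ n / 2 ≤ Real.sqrt ((v 0 : ℝ) ^ 2 + (v 1 : ℝ) ^ 2) := by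
  set N : ℝ := (2 : ℝ) ^ n with hN
  set Ng := Real.sqrt (g₀ ^ 2 + g₁ ^ 2) with hNg
  have hNsq : Ng ^ 2 = g₀ ^ 2 + g₁ ^ 2 := Real.sq_sqrt (by positivity)
  have hNpos : 0 < N := by positivity
  refine Real.le_sqrt_of_sq_le ?_
  -- the integer vector is nonzero: `v₀² + v₁² ≥ 1`
  have hone : (1 : ℝ) ≤ (v 0 : ℝ) ^ 2 + (v 1 : ℝ) ^ 2 := by
    have h : v 0 ≠ 0 ∨ v 1 ≠ 0 := by
      by_contra h'
      push Not at h'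
      exact hv (funext fun j => by fin_cases j <;> simp [h'.1, h'.2])
    rcases h with h0 | h1
    · have : (1 : ℝ) ≤ (v 0 : ℝ) ^ 2 := by
        have h1 : (1 : ℤ) ≤ (v 0) ^ 2 := by nlinarith [Int.one_le_abs h0, sq_abs (v 0)]
        exact_mod_cast h1
      nlinarith [sq_nonneg (v 1 : ℝ)]
    · have : (1 : ℝ) ≤ (v 1 : ℝ) ^ 2 := by
        have h1' : (1 : ℤ) ≤ (v 1) ^ 2 := by nlinarith [Int.one_le_abs h1, sq_abs (v 1)]
        exact_mod_cast h1'
      nlinarith [sq_nonneg (v 0 : ℝ)]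
  rcases le_or_gt n 1 with hn | hn
  · -- `N ≤ 2`
    have hN2 : N ≤ 2 := by
      rw [hN]
      calc (2 : ℝ) ^ n ≤ 2 ^ 1 := pow_le_pow_right₀ (by norm_num) hn
        _ = 2 := by norm_num
    nlinarith
  · -- `N ≥ 4`: rounding errors
    have hN4 : 4 ≤ N := by
      rw [hN]
      calc (4 : ℝ) = 2 ^ 2 := by norm_num
        _ ≤ 2 ^ n := pow_le_pow_right₀ (by norm_num) (by omega)
    set a₀ : ℝ := N * (-g₁ / Ng) with ha₀
    set a₁ : ℝ := N * (g₀ / Ng) with ha₁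
    have hsum : a₀ ^ 2 + a₁ ^ 2 = N ^ 2 := by
      rw [ha₀, ha₁]; field_simp; rw [hNsq]; ring
    have hδ₀ : |(v 0 : ℝ) - a₀| ≤ 1 / 2 := by rw [hv0, ha₀, abs_sub_comm]; exact abs_sub_round _
    have hδ₁ : |(v 1 : ℝ) - a₁| ≤ 1 / 2 := by rw [hv1, ha₁, abs_sub_comm]; exact abs_sub_round _
    have ha₀N : |a₀| ≤ N := by
      have hh := abs_le_of_sq_le_sq' (show a₀ ^ 2 ≤ N ^ 2 by nlinarith) hNpos.le
      exact abs_le.2 ⟨hh.1, hh.2⟩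
    have ha₁N : |a₁| ≤ N := by
      have hh := abs_le_of_sq_le_sq' (show a₁ ^ 2 ≤ N ^ 2 by nlinarith) hNpos.le
      exact abs_le.2 ⟨hh.1, hh.2⟩
    -- `v_j² ≥ a_j² − N`
    have key : ∀ (x a : ℝ), |x - a| ≤ 1 / 2 → |a| ≤ N → a ^ 2 - N ≤ x ^ 2 := by
      intro x a hx ha
      have h1 : -(N * (1 / 2)) ≤ a * (x - a) := by
        have := neg_abs_le (a * (x - a))
        rw [abs_mul] at this
        nlinarith [abs_nonneg a, abs_nonneg (x - a), mul_le_mul ha hx (abs_nonneg _) hNpos.le]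
      nlinarith [sq_nonneg (x - a)]
    have k0 := key _ _ hδ₀ ha₀N
    have k1 := key _ _ hδ₁ ha₁N
    nlinarith

/-- **`L ≥ 12N + 2`** from the step admissibility `2(2π/L)(N + ½) ≤ z ≤ 1`. [folklore] -/
theorem twelve_mul_le_of_step {L N z : ℝ} (hL : 0 < L) (hN : 0 < N) (hz1 : z ≤ 1)
    (hLz : 2 * (2 * π / L) * (N + 1 / 2) ≤ z) : 12 * N + 2 ≤ L := by
  have e : 2 * (2 * π / L) * (N + 1 / 2) * L = 4 * π * (N + 1 / 2) := by field_simp; norm_num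
  have h4 : 4 * π * (N + 1 / 2) ≤ z * L := by rw [← e]; exact mul_le_mul_of_nonneg_right hLz hL.le
  have hz' : z * L ≤ L := mul_le_of_le_one_left hL.le hz1
  have h12 : 12 * (N + 1 / 2) ≤ 4 * π * (N + 1 / 2) := by nlinarith only [Real.pi_gt_three, hN]
  linarith only [h12, h4, hz']

/-- **The far-range radius `R₀ = ⌊(L − 1)/(2|v|₁)⌋`**: admissible (`2|v|₁R₀ < L`) and `≥ L/(12N)` when `|v_j| ≤ N + ½`, `v ≠ 0`,
`L ≥ 12N + 2`. [folklore] -/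
theorem tangentR0_bounds {N : ℝ} (hN1 : 1 ≤ N) (v : Fin 2 → ℤ) (hv : v ≠ 0) (hvsize : ∀ j, |(v j : ℝ)| ≤ N + 1 / 2)
    {L : ℕ} [NeZero L] (hL12 : 12 * N + 2 ≤ (L : ℝ)) :
    2 * (|v 0| + |v 1|) * (((L - 1) / (2 * ((v 0).natAbs + (v 1).natAbs)) : ℕ) : ℤ) < L ∧
      (L : ℝ) / (12 * N) ≤ (((L - 1) / (2 * ((v 0).natAbs + (v 1).natAbs)) : ℕ) : ℝ) := by
  have hN0 : 0 < N := by linarith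
  have hDpos : 0 < 2 * ((v 0).natAbs + (v 1).natAbs) := by
    have : (v 0).natAbs ≠ 0 ∨ (v 1).natAbs ≠ 0 := by
      by_contra h'
      push Not at h'
      exact hv (funext fun j => by fin_cases j <;> simp [Int.natAbs_eq_zero.1 h'.1, Int.natAbs_eq_zero.1 h'.2])
    omega
  have hL1 : 1 ≤ L := Nat.pos_of_ne_zero (NeZero.ne L)
  set D : ℕ := 2 * ((v 0).natAbs + (v 1).natAbs) with hDdef
  set R₀ : ℕ := (L - 1) / D with hR₀def
  have hDz : ((D : ℕ) : ℤ) = 2 * (|v 0| + |v 1|) := by rw [hDdef]; push_cast [Int.natCast_natAbs]; ring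
  refine ⟨?_, ?_⟩
  · have h1 : R₀ * D ≤ L - 1 := Nat.div_mul_le_self _ _
    have h2 : ((R₀ * D : ℕ) : ℤ) ≤ ((L - 1 : ℕ) : ℤ) := by exact_mod_cast h1
    push_cast [Nat.cast_sub hL1] at h2
    rw [hDz] at h2
    linarith
  · have e0 : (((v 0).natAbs : ℕ) : ℝ) = |(v 0 : ℝ)| := by rw [← Int.cast_natCast, Int.natCast_natAbs, Int.cast_abs]
    have e1 : (((v 1).natAbs : ℕ) : ℝ) = |(v 1 : ℝ)| := by rw [← Int.cast_natCast, Int.natCast_natAbs, Int.cast_abs]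
    have hDle : ((D : ℕ) : ℝ) ≤ 6 * N := by
      rw [hDdef]; push_cast
      rw [e0, e1]
      linarith only [hvsize 0, hvsize 1, hN1]
    have hdiv : ((L - 1 : ℕ) : ℝ) < ((R₀ : ℕ) : ℝ) * ((D : ℕ) : ℝ) + ((D : ℕ) : ℝ) := by
      have := Nat.lt_div_mul_add hDpos (a := L - 1)
      exact_mod_cast this
    have hL1R : ((L - 1 : ℕ) : ℝ) = L - 1 := by rw [Nat.cast_sub hL1, Nat.cast_one]
    rw [hL1R] at hdiv
    have hR0 : (0 : ℝ) ≤ ((R₀ : ℕ) : ℝ) := Nat.cast_nonneg _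
    have hstep : (L : ℝ) - 1 < ((R₀ : ℕ) : ℝ) * (6 * N) + 6 * N := by
      have := mul_le_mul_of_nonneg_left hDle hR0
      linarith only [this, hdiv, hDle]
    rw [div_le_iff₀ (by positivity)]
    linarith only [hstep, hL12]

/-- **The complex modulus of a vector is at most twice its sup norm** (crudely: `√2 ≤ 2`). [folklore] -/
theorem norm_momToComplex_le_two_mul {U : ℝ} (hU : 0 ≤ U) (w : Fin 2 → ℝ) (hw : ‖w‖ ≤ U) : ‖momToComplex w‖ ≤ 2 * U := by
  have hsq := norm_momToComplex_sq w
  have h0 : |w 0| ≤ U := (norm_le_pi_norm w 0).trans hw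
  have h1 : |w 1| ≤ U := (norm_le_pi_norm w 1).trans hw
  have e0 : w 0 ^ 2 ≤ U ^ 2 := by rw [← sq_abs]; exact pow_le_pow_left₀ (abs_nonneg _) h0 2
  have e1 : w 1 ^ 2 ≤ U ^ 2 := by rw [← sq_abs]; exact pow_le_pow_left₀ (abs_nonneg _) h1 2
  have : ‖momToComplex w‖ ^ 2 ≤ (2 * U) ^ 2 := by rw [hsq]; nlinarith only [e0, e1, sq_nonneg U]
  exact (abs_le_of_sq_le_sq' this (by positivity)).2

/-- **The cell radius at neighbouring scales**: for `n₂ ≤ n₁ ≤ n₂ + 1`, `2A < Dt_min` and `Λ_{n₁}·2^{n₁} ≤ e₀`,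
`ρ = (Λ_{n₁} + s_max Dt_min (3w_{n₂}/4))/(Dt_min − 2A) ≤ ρ̄/2^{n₁}`, `ρ̄ = (e₀ + (3π/2)s_max Dt_min)/(Dt_min − 2A)`. [folklore] -/
theorem cellRadius_le {a b : ℝ} (B : BandBounds a b) {A e₀ : ℝ} (hADt : 2 * A < B.Dtmin) {n₁ n₂ : ℕ} (hn1 : n₁ ≤ n₂ + 1)
    (hΛN : klScale e₀ n₁ * (2 : ℝ) ^ n₁ ≤ e₀) :
    (klScale e₀ n₁ + B.smax * B.Dtmin * (3 * sectorWidth n₂ / 4)) / (B.Dtmin - 2 * A) ≤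
      (e₀ + 3 * π / 2 * B.smax * B.Dtmin) / (B.Dtmin - 2 * A) / (2 : ℝ) ^ n₁ := by
  have hπ := Real.pi_pos
  have hDt : 0 < B.Dtmin - 2 * A := by linarith
  have hN0 : (0 : ℝ) < (2 : ℝ) ^ n₁ := by positivity
  have hw₂ : sectorWidth n₂ ≤ 2 * π / (2 : ℝ) ^ n₁ := by
    rw [sectorWidth, div_le_div_iff₀ (by positivity) hN0]
    have : (2 : ℝ) ^ n₁ ≤ 2 * 2 ^ n₂ := by
      calc (2 : ℝ) ^ n₁ ≤ 2 ^ (n₂ + 1) := pow_le_pow_right₀ (by norm_num) hn1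
        _ = 2 * 2 ^ n₂ := by ring
    calc π * (2 : ℝ) ^ n₁ ≤ π * (2 * 2 ^ n₂) := by gcongr
      _ = 2 * π * 2 ^ n₂ := by ring
  have hsw : sectorWidth n₂ * (2 : ℝ) ^ n₁ ≤ 2 * π := (le_div_iff₀ hN0).1 hw₂
  have hsD : 0 ≤ B.smax * B.Dtmin * (3 / 4) := by
    have := B.smax_pos; have := B.Dtmin_pos; positivity
  have h2 : B.smax * B.Dtmin * (3 * sectorWidth n₂ / 4) * (2 : ℝ) ^ n₁ ≤ 3 * π / 2 * B.smax * B.Dtmin := by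
    calc B.smax * B.Dtmin * (3 * sectorWidth n₂ / 4) * (2 : ℝ) ^ n₁ = B.smax * B.Dtmin * (3 / 4) * (sectorWidth n₂ * (2 : ℝ) ^ n₁) := by
          ring
      _ ≤ B.smax * B.Dtmin * (3 / 4) * (2 * π) := mul_le_mul_of_nonneg_left hsw hsD
      _ = 3 * π / 2 * B.smax * B.Dtmin := by ring
  have hXN : (klScale e₀ n₁ + B.smax * B.Dtmin * (3 * sectorWidth n₂ / 4)) * (2 : ℝ) ^ n₁ ≤ e₀ + 3 * π / 2 * B.smax * B.Dtmin := by
    calc (klScale e₀ n₁ + B.smax * B.Dtmin * (3 * sectorWidth n₂ / 4)) * (2 : ℝ) ^ n₁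
        = klScale e₀ n₁ * (2 : ℝ) ^ n₁ + B.smax * B.Dtmin * (3 * sectorWidth n₂ / 4) * (2 : ℝ) ^ n₁ := by ring
      _ ≤ e₀ + 3 * π / 2 * B.smax * B.Dtmin := add_le_add hΛN h2
  rw [div_div, div_le_div_iff₀ hDt (by positivity)]
  calc (klScale e₀ n₁ + B.smax * B.Dtmin * (3 * sectorWidth n₂ / 4)) * ((B.Dtmin - 2 * A) * (2 : ℝ) ^ n₁)
      = (klScale e₀ n₁ + B.smax * B.Dtmin * (3 * sectorWidth n₂ / 4)) * (2 : ℝ) ^ n₁ * (B.Dtmin - 2 * A) := by ring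
    _ ≤ (e₀ + 3 * π / 2 * B.smax * B.Dtmin) * (B.Dtmin - 2 * A) := mul_le_mul_of_nonneg_right hXN hDt.le

/-- **The angular factors at scales `m ≤ n`**: `0 ≤ 1 + 2/w_m ≤ 2·2ⁿ`. [folklore] -/
theorem angularFactor_le {m n : ℕ} (hm : m ≤ n) :
    (1 + 2 * (sectorWidth m)⁻¹) ≤ 2 * (2 : ℝ) ^ n ∧ 0 ≤ (1 + 2 * (sectorWidth m)⁻¹) := by
  have hπ := Real.pi_pos
  have hwpos := sectorWidth_pos m
  have hN1 : (1 : ℝ) ≤ (2 : ℝ) ^ n := one_le_pow₀ (by norm_num)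
  refine ⟨?_, by positivity⟩
  rw [sectorWidth, inv_div]
  have h2m : (2 : ℝ) ^ m ≤ (2 : ℝ) ^ n := pow_le_pow_right₀ (by norm_num) hm
  have : 2 * (2 ^ m / π) ≤ (2 : ℝ) ^ n := by
    rw [mul_div_assoc', div_le_iff₀ hπ]
    have h3N : 3 * (2 : ℝ) ^ n ≤ (2 : ℝ) ^ n * π := by nlinarith only [Real.pi_gt_three, hN1]
    have h2p : (0 : ℝ) < (2 : ℝ) ^ m := by positivity
    linarith only [h2m, h3N, h2p]
  linarith only [this, hN1]

end Summit.HubbardSuperconductivity.HubbardSuperconductivity.Theorems.TorusFourierL2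

end
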